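import Literature.Analysis.FluidPDE.KNSSThm53OfWindow
import Literature.Analysis.FluidPDE.KNSSLiouvilleBridge
import Literature.Analysis.FluidPDE.AncientMildRepresentative
import HarnessLib

/-!
# `SphereTangentLiouville`, I: the smooth tangent representative of a decaying bounded ancient
# mild solution (KNSS 2009, §4, through the tree's proved regularity fact)

Support file for item `stmt-NavierStokesRegularity-1365` (route `CorkscrewDynamo`,
NavierStokesRegularity). Let `v` be a bounded ancient mild solution of Navier–Stokes (`ν = 1`) in
the tree's duality form, with measurable slices, the decay `r‖v(t,x)‖ ≤ C` (implied by a Type I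
bound) and slices TANGENT to the spheres about the origin, `⟪x, v(t,x)⟫ = 0`. By the tree's
bridge (`exists_stronglyMeasurable_modification`, `IsBoundedAncientMildSolution.isBoundedWeakNSSolutionOn`)
and the PROVED §4-regularity fact `KNSS2009_regularity_boundedWeak_ancient_holds`, `v = U + b(t)`
a.e. with `U` smooth; tangency pins the parasitic constant, `b(t) = −Σᵢ ⟪eᵢ, U(t,eᵢ)⟫ eᵢ` at a.e.
`t`, and the NORMALISED representative `V(t,x) = U(t,x) − Σᵢ ⟪eᵢ, U(t,eᵢ)⟫ eᵢ` does not see the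
`x`-independent jumps of `U`: it is locally Lipschitz in time at order `0` as well.

* `exists_tangent_representative_ae` — existence of `V` with: smooth divergence-free slices,
  uniform bounds on all derivatives, time-Lipschitz derivatives of order `≥ 1`,
  `‖V(t,x) − V(s,x)‖ ≤ L(‖x‖ + 3)|t − s|`, the vorticity equation (4.5) with drift `V` in
  time-integrated form, and, for a.e. `t < 0`, `v(t) = V(t)` a.e. and `⟪x, V(t,x)⟫ = 0`.

The upgrade to EVERY `t < 0` is in `CorkscrewDynamoSphereTangentLiouvilleSlices.lean`.
-/

noncomputable section

open MeasureTheory Set Function Filter InnerProductSpace Metric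
open scoped RealInnerProductSpace Topology Laplacian ContDiff
open Literature.Analysis Literature.Analysis.FluidPDE

set_option linter.dupNamespace false

namespace Summit.NavierStokesRegularity.NavierStokesRegularity.Theorems

/-- **KNSS §4 for a decaying bounded ancient mild solution (duality form).** The representation
`v(t) = U(t) + b(t)` a.e. for a.e. `t < 0` with the clauses of
`KNSS2009_regularity_boundedWeak_ancient` (smooth divergence-free slices, uniform derivative
bounds, time-Lipschitz derivatives of order `≥ 1`, the vorticity equation (4.5)), obtained by
passing to a jointly measurable bounded modification (weak-* continuity from the decay
`r‖v‖ ≤ C`) which is a bounded weak solution. -/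
theorem exists_KNSS_representative {v : ℝ → EuclideanSpace ℝ (Fin 3) → EuclideanSpace ℝ (Fin 3)}
    (hv : IsBoundedAncientMildSolution 1 v) (hmeas : ∀ t < 0, AEStronglyMeasurable (v t) volume)
    (hdecay : ∃ C : ℝ, ∀ t < 0, ∀ x, cylRadius x * ‖v t x‖ ≤ C) :
    ∃ (U : ℝ → EuclideanSpace ℝ (Fin 3) → EuclideanSpace ℝ (Fin 3))
      (b : ℝ → EuclideanSpace ℝ (Fin 3)),
      (∀ᵐ t ∂((volume : Measure ℝ).restrict (Iio 0)), v t =ᵐ[volume] fun x => U t x + b t) ∧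
      (∀ t < 0, ContDiff ℝ ∞ (U t)) ∧
      (∀ t < 0, VectorCalculus.IsDivFree (U t)) ∧
      (∀ k : ℕ, ∃ C : ℝ, ∀ t < 0, ∀ x, ‖iteratedFDeriv ℝ k (U t) x‖ ≤ C) ∧
      (∀ k : ℕ, 1 ≤ k → ∃ L : ℝ, ∀ s < 0, ∀ t < 0, ∀ x,
        ‖iteratedFDeriv ℝ k (U t) x - iteratedFDeriv ℝ k (U s) x‖ ≤ L * |t - s|) ∧
      (∀ x, ∀ s t : ℝ, s ≤ t → t < 0 →
        curl (U t) x - curl (U s) x =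
          ∫ τ in s..t, ((Δ (curl (U τ))) x - fderiv ℝ (curl (U τ)) x (U τ x + b τ) +
            fderiv ℝ (U τ) x (curl (U τ) x))) := by
  obtain ⟨M, hM⟩ := hv.2
  have hM' : ∀ t < 0, ∀ x, ‖v t x‖ ≤ M := fun t ht x => hM t ht x
  obtain ⟨C, hC⟩ := hdecay
  have hws : ∀ θ : EuclideanSpace ℝ (Fin 3) → EuclideanSpace ℝ (Fin 3),
      FunctionSpaces.IsTestFunctionOn (⊤ : TopologicalSpace.Opens (EuclideanSpace ℝ (Fin 3))) θ →
      ContinuousOn (fun t => ∫ x, ⟪v t x, θ x⟫) (Iio 0) := fun θ hθ =>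
    continuousOn_integral_inner_of_cylRadius_decay hM' hmeas hv.1.1
      (fun φ hφ hdiv => hv.continuousOn_integral_inner one_pos hmeas hφ hdiv) hC hθ
  obtain ⟨w₀, hw₀m, hw₀v⟩ := exists_stronglyMeasurable_modification hM' hmeas hws
  obtain ⟨w, hwm, hwv, hwM⟩ := exists_bounded_modification
    (μ := (volume : Measure (ℝ × EuclideanSpace ℝ (Fin 3))).restrict (Iio 0 ×ˢ univ))
    hM' hw₀m.aestronglyMeasurable hw₀v
  have hwcl : IsBoundedAncientMildSolution 1 w :=
    hv.congr_ae_slice hwv ⟨max M 0, fun t _ x => hwM t x⟩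
  have hwmeas : ∀ t < 0, AEStronglyMeasurable (w t) volume := fun t ht =>
    (hmeas t ht).congr (hwv t ht).symm
  have hweak : IsBoundedWeakNSSolutionOn (Iio 0) isOpen_Iio 1 w :=
    hwcl.isBoundedWeakNSSolutionOn one_pos hwm hwmeas
  obtain ⟨U, b, -, -, -, hrep, hsmooth, hdiv, hbdd, hlip, hvort⟩ :=
    KNSS2009_regularity_boundedWeak_ancient_holds hweak
  refine ⟨U, b, ?_, hsmooth, hdiv, hbdd, hlip, hvort⟩
  filter_upwards [hrep, ae_restrict_mem measurableSet_Iio] with t ht htneg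
  exact (hwv t htneg).symm.trans ht

/-- The tangency normalisation `x ↦ U x − Σᵢ ⟪eᵢ, U eᵢ⟫ eᵢ` does not see constants:
`(U + c) − Σᵢ ⟪eᵢ, (U + c)(eᵢ)⟫ eᵢ = U − Σᵢ ⟪eᵢ, U eᵢ⟫ eᵢ`. -/
theorem normalise_add_const (U : EuclideanSpace ℝ (Fin 3) → EuclideanSpace ℝ (Fin 3))
    (c x : EuclideanSpace ℝ (Fin 3)) :
    (U x + c) - ∑ i, ⟪EuclideanSpace.basisFun (Fin 3) ℝ i, U (EuclideanSpace.basisFun (Fin 3) ℝ i) + c⟫ •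
        EuclideanSpace.basisFun (Fin 3) ℝ i =
      U x - ∑ i, ⟪EuclideanSpace.basisFun (Fin 3) ℝ i, U (EuclideanSpace.basisFun (Fin 3) ℝ i)⟫ •
        EuclideanSpace.basisFun (Fin 3) ℝ i := by
  have hc : ∑ i, ⟪EuclideanSpace.basisFun (Fin 3) ℝ i, c⟫ • EuclideanSpace.basisFun (Fin 3) ℝ i = c :=
    (EuclideanSpace.basisFun (Fin 3) ℝ).sum_repr' c
  simp only [inner_add_right, add_smul, Finset.sum_add_distrib, hc]
  abel

/-- If a field `y ↦ U y + c` is tangent to the spheres about the origin then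
`c = −Σᵢ ⟪eᵢ, U eᵢ⟫ eᵢ`, i.e. `U + c` is the tangency normalisation of `U`. -/
theorem const_eq_of_tangent {U : EuclideanSpace ℝ (Fin 3) → EuclideanSpace ℝ (Fin 3)}
    {c : EuclideanSpace ℝ (Fin 3)} (h : ∀ y, ⟪y, U y + c⟫ = 0) :
    c = -∑ i, ⟪EuclideanSpace.basisFun (Fin 3) ℝ i, U (EuclideanSpace.basisFun (Fin 3) ℝ i)⟫ •
        EuclideanSpace.basisFun (Fin 3) ℝ i := by
  have hc : ∑ i, ⟪EuclideanSpace.basisFun (Fin 3) ℝ i, c⟫ • EuclideanSpace.basisFun (Fin 3) ℝ i = c :=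
    (EuclideanSpace.basisFun (Fin 3) ℝ).sum_repr' c
  have hi : ∀ i, ⟪EuclideanSpace.basisFun (Fin 3) ℝ i, c⟫ =
      -⟪EuclideanSpace.basisFun (Fin 3) ℝ i, U (EuclideanSpace.basisFun (Fin 3) ℝ i)⟫ := by
    intro i
    have := h (EuclideanSpace.basisFun (Fin 3) ℝ i)
    rw [inner_add_right] at this
    linarith
  conv_lhs => rw [← hc]
  simp only [hi, neg_smul, Finset.sum_neg_distrib]

/-- From the time-Lipschitz bound on `iteratedFDeriv 1`, the bound on the difference of the
Fréchet derivatives. -/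
theorem norm_fderiv_sub_fderiv_le {U : ℝ → EuclideanSpace ℝ (Fin 3) → EuclideanSpace ℝ (Fin 3)}
    {L : ℝ} {s t : ℝ} (hL0 : 0 ≤ L * |t - s|)
    (hL : ∀ x, ‖iteratedFDeriv ℝ 1 (U t) x - iteratedFDeriv ℝ 1 (U s) x‖ ≤ L * |t - s|)
    (y : EuclideanSpace ℝ (Fin 3)) :
    ‖fderiv ℝ (U t) y - fderiv ℝ (U s) y‖ ≤ L * |t - s| := by
  refine ContinuousLinearMap.opNorm_le_bound _ hL0 fun h => ?_
  have key : (fderiv ℝ (U t) y - fderiv ℝ (U s) y) h =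
      (iteratedFDeriv ℝ 1 (U t) y - iteratedFDeriv ℝ 1 (U s) y) (fun _ => h) := by
    change fderiv ℝ (U t) y h - fderiv ℝ (U s) y h =
      iteratedFDeriv ℝ 1 (U t) y (fun _ => h) - iteratedFDeriv ℝ 1 (U s) y (fun _ => h)
    rw [iteratedFDeriv_one_apply, iteratedFDeriv_one_apply]
  rw [key]
  refine (ContinuousMultilinearMap.le_opNorm _ _).trans ?_
  rw [Fin.prod_univ_one]
  exact mul_le_mul_of_nonneg_right (hL y) (norm_nonneg _)

/-- **The normalised tangent representative, almost every slice.** For a bounded ancient mild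
solution `v` (duality form, `ν = 1`) with measurable slices, the decay `r‖v‖ ≤ C` and slices
tangent to the spheres about the origin, there is `V : ℝ → ℝ³ → ℝ³` with smooth divergence-free
slices, all derivatives bounded uniformly on `(−∞,0) × ℝ³`, derivatives of order `≥ 1` Lipschitz
in time, `‖V(t,x) − V(s,x)‖ ≤ L(‖x‖+3)|t−s|`, the vorticity equation
`ω(t) − ω(s) = ∫ₛᵗ (Δω − Dω[V] + DV[ω])`, `ω = curl V`, pointwise, and such that for a.e.
`t < 0`: `v(t) = V(t)` a.e. and `V(t,·)` is tangent to the spheres (`V = U − Σᵢ⟪eᵢ,U(eᵢ)⟫eᵢ` for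
the KNSS representative `U`). -/
theorem exists_tangent_representative_ae
    {v : ℝ → EuclideanSpace ℝ (Fin 3) → EuclideanSpace ℝ (Fin 3)}
    (hv : IsBoundedAncientMildSolution 1 v) (hmeas : ∀ t < 0, AEStronglyMeasurable (v t) volume)
    (hdecay : ∃ C : ℝ, ∀ t < 0, ∀ x, cylRadius x * ‖v t x‖ ≤ C)
    (htan : ∀ t < 0, ∀ x, ⟪x, v t x⟫ = 0) :
    ∃ V : ℝ → EuclideanSpace ℝ (Fin 3) → EuclideanSpace ℝ (Fin 3),
      (∀ t < 0, ContDiff ℝ ∞ (V t)) ∧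
      (∀ t < 0, VectorCalculus.IsDivFree (V t)) ∧
      (∀ k : ℕ, ∃ C : ℝ, ∀ t < 0, ∀ x, ‖iteratedFDeriv ℝ k (V t) x‖ ≤ C) ∧
      (∀ k : ℕ, 1 ≤ k → ∃ L : ℝ, ∀ s < 0, ∀ t < 0, ∀ x,
        ‖iteratedFDeriv ℝ k (V t) x - iteratedFDeriv ℝ k (V s) x‖ ≤ L * |t - s|) ∧
      (∃ L : ℝ, 0 ≤ L ∧ ∀ s < 0, ∀ t < 0, ∀ x, ‖V t x - V s x‖ ≤ L * (‖x‖ + 3) * |t - s|) ∧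
      (∀ x, ∀ s t : ℝ, s ≤ t → t < 0 →
        curl (V t) x - curl (V s) x =
          ∫ τ in s..t, ((Δ (curl (V τ))) x - fderiv ℝ (curl (V τ)) x (V τ x) +
            fderiv ℝ (V τ) x (curl (V τ) x))) ∧
      (∀ᵐ t ∂((volume : Measure ℝ).restrict (Iio 0)), v t =ᵐ[volume] V t) ∧
      (∀ᵐ t ∂((volume : Measure ℝ).restrict (Iio 0)), ∀ x, ⟪x, V t x⟫ = 0) := by
  obtain ⟨U, b, hrep, hsmooth, hdiv, hbdd, hlip, hvort⟩ := exists_KNSS_representative hv hmeas hdecay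
  set e : OrthonormalBasis (Fin 3) ℝ (EuclideanSpace ℝ (Fin 3)) := EuclideanSpace.basisFun (Fin 3) ℝ
    with he
  set bt : ℝ → EuclideanSpace ℝ (Fin 3) := fun t => -∑ i, ⟪e i, U t (e i)⟫ • e i with hbt
  set V : ℝ → EuclideanSpace ℝ (Fin 3) → EuclideanSpace ℝ (Fin 3) := fun t x => U t x + bt t with hV
  have hVsub : ∀ t, V t = fun x => U t x - (-bt t) := fun t => by
    funext x; simp only [hV, sub_neg_eq_add]
  have hfd : ∀ t x, fderiv ℝ (fun y => U t y + bt t) x = fderiv ℝ (U t) x := fun t x =>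
    fderiv_add_const _
  have hcurl : ∀ t, curl (fun y => U t y + bt t) = curl (U t) := fun t => by
    funext x; simp only [curl_eq_curlCLM, hfd]
  -- good times: the representation holds and tangency pins `b t = bt t`
  have hgood : ∀ᵐ t ∂((volume : Measure ℝ).restrict (Iio 0)),
      b t = bt t ∧ ∀ x, ⟪x, U t x + b t⟫ = 0 := by
    filter_upwards [hrep, ae_restrict_mem measurableSet_Iio] with t ht htneg
    have hae : (fun x => ⟪x, U t x + b t⟫) =ᵐ[volume] fun _ => (0 : ℝ) := by
      filter_upwards [ht] with x hx
      rw [← hx]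
      exact htan t htneg x
    have hcont : Continuous fun x => ⟪x, U t x + b t⟫ :=
      continuous_id.inner ((hsmooth t htneg).continuous.add continuous_const)
    have hall : (fun x => ⟪x, U t x + b t⟫) = fun _ => (0 : ℝ) :=
      (Continuous.ae_eq_iff_eq volume hcont continuous_const).1 hae
    exact ⟨const_eq_of_tangent fun y => congrFun hall y, fun y => congrFun hall y⟩
  refine ⟨V, fun t ht => (hsmooth t ht).add contDiff_const, fun t ht x => ?_, fun k => ?_,
    fun k hk => ?_, ?_, fun x s t hst ht => ?_, ?_, ?_⟩
  · -- divergence free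
    have := hdiv t ht x
    simpa only [VectorCalculus.divergence, hV, hfd] using this
  · -- uniform bounds on all derivatives
    cases k with
    | zero =>
      obtain ⟨C₀, hC₀⟩ := hbdd 0
      refine ⟨C₀ + 3 * C₀, fun t ht x => ?_⟩
      have h0 : ∀ y, ‖U t y‖ ≤ C₀ := fun y => by
        have := hC₀ t ht y
        rwa [norm_iteratedFDeriv_zero] at this
      rw [norm_iteratedFDeriv_zero]
      have hb : ‖bt t‖ ≤ 3 * C₀ := by
        simp only [hbt, norm_neg]
        refine (norm_sum_le _ _).trans ?_
        have h1 : ∀ i, ‖⟪e i, U t (e i)⟫ • e i‖ ≤ C₀ := fun i => by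
          have hei : ‖e i‖ = 1 := e.orthonormal.norm_eq_one i
          rw [norm_smul, hei, mul_one, Real.norm_eq_abs]
          refine (abs_real_inner_le_norm _ _).trans ?_
          rw [hei, one_mul]
          exact h0 _
        calc ∑ i, ‖⟪e i, U t (e i)⟫ • e i‖ ≤ ∑ _i : Fin 3, C₀ := Finset.sum_le_sum fun i _ => h1 i
          _ = 3 * C₀ := by simp
      calc ‖V t x‖ ≤ ‖U t x‖ + ‖bt t‖ := norm_add_le _ _
        _ ≤ C₀ + 3 * C₀ := add_le_add (h0 x) hb
    | succ n =>
      obtain ⟨C, hC⟩ := hbdd (n + 1)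
      refine ⟨C, fun t ht x => ?_⟩
      rw [hVsub t, iteratedFDeriv_succ_sub_const]
      exact hC t ht x
  · -- time-Lipschitz derivatives of order `≥ 1`
    obtain ⟨n, rfl⟩ : ∃ n, k = n + 1 := ⟨k - 1, by omega⟩
    obtain ⟨L, hL⟩ := hlip (n + 1) hk
    refine ⟨L, fun s hs t ht x => ?_⟩
    rw [hVsub t, hVsub s, iteratedFDeriv_succ_sub_const, iteratedFDeriv_succ_sub_const]
    exact hL s hs t ht x
  · -- order `0`: local Lipschitz in time
    obtain ⟨L, hL⟩ := hlip 1 le_rfl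
    have hL0 : 0 ≤ L := by
      have h := hL (-1) (by norm_num) (-2) (by norm_num) 0
      have h' : (0 : ℝ) ≤ L * |(-2 : ℝ) - -1| := (norm_nonneg _).trans h
      norm_num at h'
      exact h'
    refine ⟨L, hL0, fun s hs t ht x => ?_⟩
    set f : EuclideanSpace ℝ (Fin 3) → EuclideanSpace ℝ (Fin 3) := fun y => U t y - U s y with hf
    have hLts : 0 ≤ L * |t - s| := mul_nonneg hL0 (abs_nonneg _)
    have hfd' : ∀ y, DifferentiableAt ℝ f y := fun y =>
      (((hsmooth t ht).differentiable (by simp)) y).sub (((hsmooth s hs).differentiable (by simp)) y)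
    have hfb : ∀ y, ‖fderiv ℝ f y‖ ≤ L * |t - s| := by
      intro y
      rw [hf, fderiv_fun_sub (((hsmooth t ht).differentiable (by simp)) y)
        (((hsmooth s hs).differentiable (by simp)) y)]
      exact norm_fderiv_sub_fderiv_le hLts (hL s hs t ht) y
    have hmv : ∀ y, ‖f y - f 0‖ ≤ L * |t - s| * ‖y‖ := fun y => by
      have := Convex.norm_image_sub_le_of_norm_fderiv_le (fun z _ => hfd' z) (fun z _ => hfb z)
        convex_univ (mem_univ 0) (mem_univ y)
      rwa [sub_zero] at this
    have hident : V t x - V s x = (f x - f 0) - ∑ i, ⟪e i, f (e i) - f 0⟫ • e i := by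
      have h0t : ∑ i, ⟪e i, U t 0⟫ • e i = U t 0 := e.sum_repr' _
      have h0s : ∑ i, ⟪e i, U s 0⟫ • e i = U s 0 := e.sum_repr' _
      simp only [hV, hbt, hf, inner_sub_right, sub_smul, Finset.sum_sub_distrib, h0t, h0s]
      abel
    rw [hident]
    have h1 : ‖∑ i, ⟪e i, f (e i) - f 0⟫ • e i‖ ≤ 3 * (L * |t - s|) := by
      refine (norm_sum_le _ _).trans ?_
      have h2 : ∀ i, ‖⟪e i, f (e i) - f 0⟫ • e i‖ ≤ L * |t - s| := fun i => by
        have hei : ‖e i‖ = 1 := e.orthonormal.norm_eq_one i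
        rw [norm_smul, hei, mul_one, Real.norm_eq_abs]
        refine (abs_real_inner_le_norm _ _).trans ?_
        rw [hei, one_mul]
        refine (hmv (e i)).trans ?_
        rw [hei, mul_one]
      calc ∑ i, ‖⟪e i, f (e i) - f 0⟫ • e i‖ ≤ ∑ _i : Fin 3, L * |t - s| :=
            Finset.sum_le_sum fun i _ => h2 i
        _ = 3 * (L * |t - s|) := by simp
    calc ‖(f x - f 0) - ∑ i, ⟪e i, f (e i) - f 0⟫ • e i‖
        ≤ ‖f x - f 0‖ + ‖∑ i, ⟪e i, f (e i) - f 0⟫ • e i‖ := norm_sub_le _ _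
      _ ≤ L * |t - s| * ‖x‖ + 3 * (L * |t - s|) := add_le_add (hmv x) h1
      _ = L * (‖x‖ + 3) * |t - s| := by ring
  · -- the vorticity equation with drift `V`
    simp only [hV, hcurl, hfd]
    rw [hvort x s t hst ht]
    refine intervalIntegral.integral_congr_ae ?_
    have hg := (ae_restrict_iff' measurableSet_Iio).1 hgood
    filter_upwards [hg] with τ hτ hτmem
    rw [uIoc_of_le hst] at hτmem
    have hτ0 : τ < 0 := lt_of_le_of_lt hτmem.2 ht
    obtain ⟨hb, -⟩ := hτ hτ0
    rw [hb]
  · -- `v = V` a.e., for a.e. `t`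
    filter_upwards [hrep, hgood] with t ht hg
    have : V t = fun x => U t x + b t := by funext x; simp only [hV, hg.1]
    rw [this]
    exact ht
  · -- tangency for a.e. `t`
    filter_upwards [hgood] with t hg
    intro x
    simp only [hV, ← hg.1]
    exact hg.2 x

end Summit.NavierStokesRegularity.NavierStokesRegularity.Theorems
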